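import Literature.MathematicalPhysics.QuantumFieldTheory.Balaban1983to89.LatticeFieldCalculus
import Literature.MathematicalPhysics.QuantumFieldTheory.Balaban1983to89.B12RegularSpaces111
import Literature.MathematicalPhysics.QuantumFieldTheory.Balaban1983to89.B5AveragingLocalityV1

/-!
# BalabanUVNodes ∕ node N18 = NE5 — closure-ledger item (iii), the (I.1.12) half of the transport clause: KING'S K-ROW FOR THE LINEAR BLOCK
# AVERAGE `Q = bondAvg` ON NORMED-SPACE-VALUED BOND FIELDS — sup-contraction (K-a) and EXACT gradient contraction (K-b), local and global editions
# (Track A, DAG node N18 = `T4OutputRate.NE5` :211; cluster K4 «SpineRates», item K3⁷ `SpineGivenEndpointR13SepCoPH`; module 19a of seat pub-ymgap-dag-n18-d,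
# strategy s2)

HONEST FRAMING.  Count-neutral kernel bookkeeping (`--supports stmt-QuantumFields-20544 --as helper`); elementary lattice facts, PROVED.  NE5 is NOT PRINTED and
NOT proved; N18 is NOT discharged; the transport clause `hT` of `ReadingData∕LevelPairing.ofRecordAdm` at the table of record `spaceI` is NOT discharged here.

WHY.  The closure ledger of this seat (HOME `HANDOFF.md` «N18 CLOSURE LEDGER» (iii)) lists the transport clause `hT : ∀ U, (∀ j Y, (ιU, 0) ∈ sp (k+1) j Y) →
∀ j Y, (ι(T₀U), 0) ∈ sp k j Y` at the TABLE OF RECORD `sp = spaceI` ([I] (1.11)–(1.16)); its (1.11) half is a theorem (module 13 `…N18AdmTransportPlaqSmall`,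
`admTransport_plaqSmall(_sharp)`), its (1.12) half («for each cube □ ⊂ X of a size O(1)LM there exists a G-valued gauge transformation u … U^u = exp iξA,
|A|, |∇^ξA| < O(1)LMBα₀ on □», `B12RegularSpaces111.CondI.localGauge`) is OPEN.  The LENS «transfer» card T36 (`ym-lens-BalabanUVNodes-transfer/LENS-transfer.md`
§29, 2026-08-27) located the road: under the transport of record the first-order term of the averaged field is `L·(QY) − dλ̄` with `Q = LatticeFieldCalculus.bondAvg`
(`BlockAveragingEMLLinearised.linAvg_eq_bondAvg_sub_grad_combMean`), so the (1.12) letters `|A|`, `|∇^ξA|` are governed — at first order and modulo the coarse pure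
gauge — by KING'S K-ROW for `Q` ([King1986] Lemma 4.5: the linear block operator contracts sup norms and commutes with lattice derivatives up to `ξ ↦ Lξ`).  The
lens proved the `ℤ`-model (`LensTransferSketch23.norm_lineMean_le ∕ norm_grad_lineMean_le`) and named as the typed next step the TORUS EDITIONS over
`LatticeFieldCalculus.bondAvg` on matrix-valued fields.  This file types them, for bond fields with values in ANY real (semi)normed space `V` — so for
`Matrix n n ℂ` and for every complete normed `ℂ`-algebra `𝔸` of `B12RegularSpaces111` (through `NormedSpace.complexToReal`) — in LOCAL form (hypotheses only on
the `L^{d+1}` feeding bonds ∕ the `L^{d+2}` feeding unit differences, which is what a cube-local condition like (1.12) supplies) and in global form.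

WHAT.
* §1 (K-a) `norm_segSum_le_of_forall`; ★ `norm_bondAvg_le_of_forall_run` (`‖(QY)(c)‖ ≤ a` from `‖Y‖ ≤ a` on the feeding bonds `runBond (blockSite c₋ r) (dir c) t`,
  `t < L`); `norm_bondAvg_le_of_local` (the same, `blockOf`-phrased through `B5AveragingLocalityV1.runBond_blockSite_local`).  The GLOBAL edition
  `‖Y‖_∞ ≤ a ⇒ ‖QY‖_∞ ≤ a` is already the tree's `BIJ85GaugeFnBound513.norm_bondAvg_le` (+ `norm_bondAvgIter_le`) — cited, not restated.
* §2 (K-b) `runSite_runSite_comm`, `segSum_runSite_sub_eq_sum`, ★ `bondAvg_shift_sub_eq_sum` (standing range: `(QY)(y + e_ν, μ) − (QY)(y, μ)` IS the mean of the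
  `L^{d+2}` unit `ν`-differences of `x ↦ Y(x, μ)` at the feeding sites, times `L` — ONE telescoping per straight contour), ★ `norm_bondAvg_shift_sub_le_of_forall_run`
  (LOCAL: `≤ L·δ`), `norm_bondAvg_shift_sub_le_of_forall`, ★ `norm_pdiff_bondAvg_le_of_forall` (`LatticeFieldCalculus.pdiff`, lattice factor `c ↦ c∕L`:
  `‖∂^{c∕L}_ν (QY)_μ‖ ≤ sup ‖∂^c_ν Y_μ‖` — EXACT, no loss), ★ `norm_grad_bondAvg_le_of_forall` (the (1.12) letter verbatim: `B12RegularSpaces111.grad`, `ξ ↦ L·ξ`).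
Sibling module 19b `…N18CondILevelNesting` types the level-nesting (α) of conditions (i)–(iii) at the frame of record.

WHAT THIS IS NOT.  Not the transport clause at `spaceI` (the lens's (β): covariance `BlockAveraging.avgFun_covariant` + the coarse gauge `v(y)` of
[Balaban1985Averaging] (62)–(63) + the second-order remainder `norm_avgFun_sub_one_sub_linAvg_le`, and (γ): the per-table step law `hstepB`, remain — real
analysis, other sessions∕lanes); not a claim that (1.12) follows from (1.11) (it does not; print imposes it, [I] p. 262); finite tori, fixed `ε` — not continuum ∕
OS ∕ mass gap ∕ Clay.  0 `def`, 0 `sorry`, standard axioms.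
-/

open scoped BigOperators

namespace YMDAG.N18.CondIKRow

open Literature.MathematicalPhysics.QuantumFieldTheory.Balaban1983to89
open Literature.MathematicalPhysics.QuantumFieldTheory.Balaban1983to89.LatticeFieldCalculus

/-! ## §1 (K-a) THE LINEAR BLOCK AVERAGE IS A SUP-CONTRACTION -/

section KA

variable {P : Params} {j : ℕ} {V : Type*} [SeminormedAddCommGroup V] [NormedSpace ℝ V]

omit [NormedSpace ℝ V] in
/-- `‖Y([x, x + n e_μ])‖ ≤ n·a` when `‖Y‖ ≤ a` on the `n` bonds of the straight contour. [cite: Balaban1984PropagatorsI, (1.8) p.19] -/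
theorem norm_segSum_le_of_forall (Y : VecField P j V) (x : Site P j) (μ : Fin P.d) (n : ℕ) {a : ℝ}
    (hY : ∀ t < n, ‖Y (runBond x μ t)‖ ≤ a) : ‖segSum Y x μ n‖ ≤ n * a := by
  unfold segSum
  calc ‖∑ t ∈ Finset.range n, Y (runBond x μ t)‖
      ≤ ∑ t ∈ Finset.range n, ‖Y (runBond x μ t)‖ := norm_sum_le _ _
    _ ≤ ∑ _t ∈ Finset.range n, a := Finset.sum_le_sum fun t ht => hY t (Finset.mem_range.mp ht)
    _ = n * a := by rw [Finset.sum_const, Finset.card_range, nsmul_eq_mul]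

/-- **(K-a), LOCAL**: `(QY)(c)` is the mean of the `L^{d+1}` values of `Y` on the feeding bonds `runBond (blockSite c₋ r) (dir c) t`, `r ∈ {0,…,L−1}^d`,
`t < L`; so `‖Y‖ ≤ a` on those bonds gives `‖(QY)(c)‖ ≤ a` (King's `‖Q‖_{∞→∞} ≤ 1`, [King1986] Lemma 4.5, for the block average of
[Balaban1984PropagatorsI] (1.11)). [cite: Balaban1984PropagatorsI, (1.11) p.19] -/
theorem norm_bondAvg_le_of_forall_run (Y : VecField P j V) (c : PBond P (j + 1)) {a : ℝ}
    (hY : ∀ r : Fin P.d → Fin P.L, ∀ t < P.L, ‖Y (runBond (Site.blockSite c.src r) c.dir t)‖ ≤ a) :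
    ‖bondAvg Y c‖ ≤ a := by
  have hLpos : (0 : ℝ) < (P.L : ℝ) := Nat.cast_pos.2 P.L_pos
  have hLd : (0 : ℝ) < (P.L : ℝ) ^ (P.d + 1) := pow_pos hLpos _
  have hseg : ∀ r : Fin P.d → Fin P.L, ‖segSum Y (Site.blockSite c.src r) c.dir P.L‖ ≤ (P.L : ℝ) * a := fun r =>
    norm_segSum_le_of_forall Y _ _ _ (hY r)
  unfold bondAvg
  rw [norm_smul, norm_inv, Real.norm_of_nonneg hLd.le]
  calc ((P.L : ℝ) ^ (P.d + 1))⁻¹ * ‖∑ r : Fin P.d → Fin P.L, segSum Y (Site.blockSite c.src r) c.dir P.L‖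
      ≤ ((P.L : ℝ) ^ (P.d + 1))⁻¹ * ∑ r : Fin P.d → Fin P.L, ‖segSum Y (Site.blockSite c.src r) c.dir P.L‖ := by
        gcongr
        exact norm_sum_le _ _
    _ ≤ ((P.L : ℝ) ^ (P.d + 1))⁻¹ * ∑ _r : Fin P.d → Fin P.L, (P.L : ℝ) * a := by
        gcongr with r
        exact hseg r
    _ = a := by
        rw [Finset.sum_const, Finset.card_univ, Fintype.card_fun, Fintype.card_fin, Fintype.card_fin, nsmul_eq_mul]
        push_cast
        field_simp
        ring

/-- **(K-a), `blockOf`-phrased** (standing range): `‖Y(b)‖ ≤ a` for every fine bond `b` with both endpoints in `B(c₋) ∪ B(c₊)` gives `‖(QY)(c)‖ ≤ a`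
(the feeding bonds are such, `B5AveragingLocalityV1.runBond_blockSite_local`). [cite: Balaban1984PropagatorsI, (1.11) p.19] -/
theorem norm_bondAvg_le_of_local (hj : j + 1 ≤ P.m + P.K) (Y : VecField P j V) (c : PBond P (j + 1)) {a : ℝ}
    (hY : ∀ b : PBond P j, (blockOf b.src = c.src ∨ blockOf b.src = c.tgt) → (blockOf b.tgt = c.src ∨ blockOf b.tgt = c.tgt) → ‖Y b‖ ≤ a) :
    ‖bondAvg Y c‖ ≤ a :=
  norm_bondAvg_le_of_forall_run Y c fun r _ ht =>
    have hl := B5AveragingLocalityV1.runBond_blockSite_local hj c r ht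
    hY _ hl.1 hl.2

-- (K-a), GLOBAL (`‖Y‖_∞ ≤ a ⇒ ‖QY‖_∞ ≤ a`) is ALREADY in the tree: `BalabanImbrieJaffe1984to88.BIJ85GaugeFnBound513.norm_bondAvg_le` (with the iterate
-- `norm_bondAvgIter_le`) — cite it by that name; not restated here (gate `dedup.landed`).

end KA

/-! ## §2 (K-b) THE LINEAR BLOCK AVERAGE COMMUTES WITH LATTICE DIFFERENCES UP TO `ξ ↦ Lξ`: EXACT GRADIENT CONTRACTION -/

section KB

variable {P : Params} {j : ℕ} {V : Type*}

/-- Straight runs in two directions commute: `(x + t e_μ) + s e_ν = (x + s e_ν) + t e_μ`. [folklore] -/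
theorem runSite_runSite_comm (x : Site P j) (μ ν : Fin P.d) (t s : ℕ) :
    runSite (runSite x μ t) ν s = runSite (runSite x ν s) μ t := by
  unfold runSite
  by_cases h : ν = μ
  · subst h
    simp only [Function.update_self, Function.update_idem]
    congr 1
    ring
  · rw [Function.update_of_ne h, Function.update_of_ne (Ne.symm h), Function.update_comm h]

variable [AddCommGroup V] [Module ℝ V]

omit [Module ℝ V] in
/-- ONE TELESCOPING PER STRAIGHT CONTOUR: the difference of the contour sums of `Y_μ` along `[x + L e_ν, x + L e_ν + n e_μ]` and `[x, x + n e_μ]` is the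
sum over the `n` contour bonds and the `L` unit steps of the unit `ν`-differences of `z ↦ Y(z, μ)`. [cite: Balaban1984PropagatorsI, (1.8) p.19] -/
theorem segSum_runSite_sub_eq_sum (Y : VecField P j V) (x : Site P j) (μ ν : Fin P.d) (n : ℕ) :
    segSum Y (runSite x ν P.L) μ n - segSum Y x μ n =
      ∑ t ∈ Finset.range n, ∑ s ∈ Finset.range P.L,
        (Y ⟨(runSite (runSite x μ t) ν s).shift ν, μ⟩ - Y ⟨runSite (runSite x μ t) ν s, μ⟩) := by
  unfold segSum
  rw [← Finset.sum_sub_distrib]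
  refine Finset.sum_congr rfl fun t _ => ?_
  have htel := Finset.sum_range_sub (fun s => Y ⟨runSite (runSite x μ t) ν s, μ⟩) P.L
  simp only [runSite_zero] at htel
  simp only [← runSite_succ]
  rw [htel, runBond, runBond, runSite_runSite_comm x ν μ P.L t]

/-- **`(QY)(y + e_ν, μ) − (QY)(y, μ)` AS A MEAN OF UNIT DIFFERENCES** (standing range): with `x_r = blockSite y r`,
`(QY)(⟨y + e_ν, μ⟩) − (QY)(⟨y, μ⟩) = L^{−(d+1)} Σ_r Σ_{t<L} Σ_{s<L} [Y((x_r + t e_μ + s e_ν) + e_ν, μ) − Y(x_r + t e_μ + s e_ν, μ)]` — the block of `y + e_ν` is the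
block of `y` translated by `L e_ν` (`runSite_blockSite_L`), and each contour difference telescopes (`segSum_runSite_sub_eq_sum`).
[cite: Balaban1984PropagatorsI, (1.11) p.19] -/
theorem bondAvg_shift_sub_eq_sum (hj : j + 1 ≤ P.m + P.K) (Y : VecField P j V) (y : Site P (j + 1)) (μ ν : Fin P.d) :
    bondAvg Y ⟨y.shift ν, μ⟩ - bondAvg Y ⟨y, μ⟩ =
      (((P.L : ℝ) ^ (P.d + 1))⁻¹) • ∑ r : Fin P.d → Fin P.L, ∑ t ∈ Finset.range P.L, ∑ s ∈ Finset.range P.L,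
        (Y ⟨(runSite (runSite (Site.blockSite y r) μ t) ν s).shift ν, μ⟩ - Y ⟨runSite (runSite (Site.blockSite y r) μ t) ν s, μ⟩) := by
  unfold bondAvg
  rw [← smul_sub, ← Finset.sum_sub_distrib]
  congr 1
  refine Finset.sum_congr rfl fun r _ => ?_
  show segSum Y (Site.blockSite (y.shift ν) r) μ P.L - segSum Y (Site.blockSite y r) μ P.L = _
  rw [← runSite_blockSite_L hj y r ν, segSum_runSite_sub_eq_sum]

end KB

section KBNorm

variable {P : Params} {j : ℕ} {V : Type*} [SeminormedAddCommGroup V] [NormedSpace ℝ V]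

/-- **(K-b), LOCAL** (standing range): if the unit `ν`-differences of `x ↦ Y(x, μ)` are `≤ δ` in norm at the `L^{d+2}` feeding sites
`blockSite y r + t e_μ + s e_ν` (`t, s < L`), then `‖(QY)(y + e_ν, μ) − (QY)(y, μ)‖ ≤ L·δ` — i.e. the COARSE unit difference of `QY` costs exactly `L` fine
ones: King's `∇Q = Q̃∇` with `‖Q̃‖_{∞→∞} ≤ 1` ([King1986] Lemma 4.5 (4.38)) for [Balaban1984PropagatorsI]'s `Q`. [cite: Balaban1984PropagatorsI, (1.11) p.19] -/
theorem norm_bondAvg_shift_sub_le_of_forall_run (hj : j + 1 ≤ P.m + P.K) (Y : VecField P j V) (y : Site P (j + 1)) (μ ν : Fin P.d)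
    {δ : ℝ} (hY : ∀ r : Fin P.d → Fin P.L, ∀ t < P.L, ∀ s < P.L,
      ‖Y ⟨(runSite (runSite (Site.blockSite y r) μ t) ν s).shift ν, μ⟩ - Y ⟨runSite (runSite (Site.blockSite y r) μ t) ν s, μ⟩‖ ≤ δ) :
    ‖bondAvg Y ⟨y.shift ν, μ⟩ - bondAvg Y ⟨y, μ⟩‖ ≤ P.L * δ := by
  have hLpos : (0 : ℝ) < (P.L : ℝ) := Nat.cast_pos.2 P.L_pos
  have hLd : (0 : ℝ) < (P.L : ℝ) ^ (P.d + 1) := pow_pos hLpos _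
  rw [bondAvg_shift_sub_eq_sum hj, norm_smul, norm_inv, Real.norm_of_nonneg hLd.le]
  calc ((P.L : ℝ) ^ (P.d + 1))⁻¹ * ‖∑ r : Fin P.d → Fin P.L, ∑ t ∈ Finset.range P.L, ∑ s ∈ Finset.range P.L,
          (Y ⟨(runSite (runSite (Site.blockSite y r) μ t) ν s).shift ν, μ⟩ - Y ⟨runSite (runSite (Site.blockSite y r) μ t) ν s, μ⟩)‖
      ≤ ((P.L : ℝ) ^ (P.d + 1))⁻¹ * ∑ r : Fin P.d → Fin P.L, ∑ t ∈ Finset.range P.L, ∑ s ∈ Finset.range P.L,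
          ‖Y ⟨(runSite (runSite (Site.blockSite y r) μ t) ν s).shift ν, μ⟩ - Y ⟨runSite (runSite (Site.blockSite y r) μ t) ν s, μ⟩‖ := by
        gcongr
        refine (norm_sum_le _ _).trans (Finset.sum_le_sum fun r _ => ?_)
        refine (norm_sum_le _ _).trans (Finset.sum_le_sum fun t _ => ?_)
        exact norm_sum_le _ _
    _ ≤ ((P.L : ℝ) ^ (P.d + 1))⁻¹ * ∑ _r : Fin P.d → Fin P.L, ∑ _t ∈ Finset.range P.L, ∑ _s ∈ Finset.range P.L, δ := by
        gcongr with r _ t ht s hs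
        exact hY r t (Finset.mem_range.mp ht) s (Finset.mem_range.mp hs)
    _ = P.L * δ := by
        simp only [Finset.sum_const, Finset.card_range, Finset.card_univ, Fintype.card_fun, Fintype.card_fin, nsmul_eq_mul]
        push_cast
        field_simp
        ring

/-- **(K-b), global** (standing range): `‖Y(x + e_ν, μ) − Y(x, μ)‖ ≤ δ` for all `x` gives `‖(QY)(y + e_ν, μ) − (QY)(y, μ)‖ ≤ L·δ` for all `y`.
[cite: Balaban1984PropagatorsI, (1.11) p.19] -/
theorem norm_bondAvg_shift_sub_le_of_forall (hj : j + 1 ≤ P.m + P.K) (Y : VecField P j V) (μ ν : Fin P.d) {δ : ℝ}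
    (hY : ∀ x : Site P j, ‖Y ⟨x.shift ν, μ⟩ - Y ⟨x, μ⟩‖ ≤ δ) (y : Site P (j + 1)) :
    ‖bondAvg Y ⟨y.shift ν, μ⟩ - bondAvg Y ⟨y, μ⟩‖ ≤ P.L * δ :=
  norm_bondAvg_shift_sub_le_of_forall_run hj Y y μ ν fun _ _ _ _ _ => hY _

/-- **(K-b) WITH THE LATTICE FACTOR** (standing range): for the forward difference `∂^c_ν f(x) = c·(f(x + e_ν) − f(x))` of `LatticeFieldCalculus.pdiff`, the
coarse factor being `c∕L` (spacing `× L`), `sup_y ‖∂^{c∕L}_ν (QY)(·, μ)(y)‖ ≤ sup_x ‖∂^c_ν Y(·, μ)(x)‖` — EXACT, no loss ([King1986] (4.38) `∇Q = Q̃∇`,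
`‖Q̃‖ ≤ 1`). [cite: Balaban1984PropagatorsI, (1.13) p.19] -/
theorem norm_pdiff_bondAvg_le_of_forall (hj : j + 1 ≤ P.m + P.K) (Y : VecField P j V) (c : ℝ) (μ ν : Fin P.d) {g : ℝ}
    (hY : ∀ x : Site P j, ‖pdiff c ν (fun x => Y ⟨x, μ⟩) x‖ ≤ g) (y : Site P (j + 1)) :
    ‖pdiff (c / P.L) ν (fun y => bondAvg Y ⟨y, μ⟩) y‖ ≤ g := by
  have hLpos : (0 : ℝ) < (P.L : ℝ) := Nat.cast_pos.2 P.L_pos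
  have hg : 0 ≤ g := (norm_nonneg _).trans (hY default)
  simp only [pdiff] at hY ⊢
  rw [norm_smul, Real.norm_eq_abs, abs_div, abs_of_pos hLpos]
  by_cases hc : c = 0
  · rw [hc, abs_zero, zero_div, zero_mul]
    exact hg
  · have hcpos : 0 < |c| := abs_pos.mpr hc
    -- the unit differences are bounded by `g ∕ |c|`
    have hδ : ∀ x : Site P j, ‖Y ⟨x.shift ν, μ⟩ - Y ⟨x, μ⟩‖ ≤ g / |c| := fun x => by
      have h := hY x
      rw [norm_smul, Real.norm_eq_abs] at h
      rw [le_div_iff₀ hcpos, mul_comm]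
      exact h
    have hQ := norm_bondAvg_shift_sub_le_of_forall hj Y μ ν hδ y
    calc |c| / P.L * ‖bondAvg Y ⟨y.shift ν, μ⟩ - bondAvg Y ⟨y, μ⟩‖
        ≤ |c| / P.L * (P.L * (g / |c|)) := by gcongr
      _ = g := by field_simp

end KBNorm

section KBGrad

variable {P : Params} {j : ℕ} {𝔸 : Type*} [NormedRing 𝔸] [NormedAlgebra ℂ 𝔸]

/-- **(K-b) FOR THE (1.12) LETTER VERBATIM** (standing range): for the `ξ`-lattice derivative `(∇^ξ_ν F)(x) = ξ⁻¹(F(x + e_ν) − F(x))` of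
`B12RegularSpaces111.grad` on `𝔸`-valued fields (`𝔸` a normed `ℂ`-algebra, e.g. `M_N(ℂ)`), the coarse spacing being `L·ξ`:
`sup_y ‖∇^{Lξ}_ν (QY)(·, μ)(y)‖ ≤ sup_x ‖∇^{ξ}_ν Y(·, μ)(x)‖` — the `|∇^ξA|`-letter of (I.1.12) is carried EXACTLY through the linear block average `Q` of
[Balaban1984PropagatorsI] (1.11) (King's K-row, [King1986] Lemma 4.5). [cite: Balaban1987RG1, (1.12) p.262] -/
theorem norm_grad_bondAvg_le_of_forall (hj : j + 1 ≤ P.m + P.K) (Y : VecField P j 𝔸) (ξ : ℝ) (μ ν : Fin P.d) {g : ℝ}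
    (hY : ∀ x : Site P j, ‖B12RegularSpaces111.grad ξ ν (fun x => Y ⟨x, μ⟩) x‖ ≤ g) (y : Site P (j + 1)) :
    ‖B12RegularSpaces111.grad (P.L * ξ) ν (fun y => bondAvg Y ⟨y, μ⟩) y‖ ≤ g := by
  have hLpos : (0 : ℝ) < (P.L : ℝ) := Nat.cast_pos.2 P.L_pos
  have hg : 0 ≤ g := (norm_nonneg _).trans (hY default)
  simp only [B12RegularSpaces111.grad] at hY ⊢
  rw [norm_smul, norm_inv]
  by_cases hξ : ξ = 0
  · simp only [hξ, mul_zero, Complex.ofReal_zero, norm_zero, inv_zero, zero_mul]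
    exact hg
  · have hξpos : 0 < |ξ| := abs_pos.mpr hξ
    have hnorm : ‖((P.L * ξ : ℝ) : ℂ)‖ = P.L * |ξ| := by
      rw [Complex.norm_real, Real.norm_eq_abs, abs_mul, abs_of_pos hLpos]
    rw [hnorm]
    -- the unit differences are bounded by `|ξ|·g`
    have hδ : ∀ x : Site P j, ‖Y ⟨x.shift ν, μ⟩ - Y ⟨x, μ⟩‖ ≤ |ξ| * g := fun x => by
      have h := hY x
      rw [norm_smul, norm_inv, Complex.norm_real, Real.norm_eq_abs] at h
      rwa [inv_mul_le_iff₀ hξpos] at h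
    have hQ := norm_bondAvg_shift_sub_le_of_forall hj Y μ ν hδ y
    calc (P.L * |ξ|)⁻¹ * ‖bondAvg Y ⟨y.shift ν, μ⟩ - bondAvg Y ⟨y, μ⟩‖
        ≤ (P.L * |ξ|)⁻¹ * (P.L * (|ξ| * g)) := by gcongr
      _ = g := by field_simp

end KBGrad

end YMDAG.N18.CondIKRow
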